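import Mathlib
import Summits.CriticalPhenomena.PercolationContinuityZ3.Theorems.PercNearOneGluingNoHeavyLowerTailOrientedAntipodalHallCyclicMSDown
import Summits.CriticalPhenomena.PercolationContinuityZ3.Theorems.PercNearOneGluingNoHeavyLowerTailThreeFamilyRank

/-!
# Cyclic selections: the Hall count from the linear-algebra statement `TRIPLE`

Helper file for crux `stmt-CriticalPhenomena-4575` (`NoHeavyLowerTail`, route `PercNearOneGluingNoHeavy`),
new-inequality factory seat `prim-ineq-gen-3` (gen 9).  Everything here is PROVED; the open statement enters
as the hypothesis `hTriple`.

`ThreeFamilyRank.card_add_card_add_card_le` (Theorem A′) bounds `#P + #Q + #R` by `#G + finrank (V_P ⊓ V_Q ⊓ V_R)`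
for any down-closed `G` containing the within-family differences and the cross meets of three pairwise
cross-intersecting families.  Here `G = G(S; P, Q, R)` is the concrete counted family of the socket
`OrientedAntipodalHall.card_le_card_goods_above_cyclic_of_down` (subsets of `S` inside some within-family
difference, cross meet or double difference), so the combinatorial hypothesis `hMS3down` of that socket is
implied by

> `TRIPLE`: `V_P ⊓ V_Q ⊓ V_R = ⊥` in `ℚ^{G(S;P,Q,R)}` (`V_T` = span of the plain vectors `([E ⊆ X])_{E ∈ G}`, `X ∈ T`),

which holds in every instance tested (exhaustive `LAB=1` on 6 points, random cross-intersecting triples on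
≤ 9 points; memo `run/shared/lean/prim/prim-ineq-gen-3/MS3-STATE.md` §8).  `TRIPLE` needs the double
differences in `G`: for `P = {sa,sb,sab}`, `Q = {sc,sd,scd}`, `R = {se,sf,sef}` the plain vector of `{s}` lies
in all three spans over `↓(differences ∪ meets)` (and indeed `m = 9 > 8`), while the double difference
`ab = sab \ (sc ∪ se)` separates them.  (prim-ineq-gen-3 gen 9, 2026-08-20.)
-/

namespace Summit.CriticalPhenomena.PercolationContinuityZ3.Theorems

namespace ThreeFamilyRank

open Finset Module
open scoped FinsetFamily

variable {α : Type*} [DecidableEq α]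

/-! ### The bridge to the cyclic Hall count

`G` is now the concrete down-closed family of the socket
`OrientedAntipodalHall.card_le_card_goods_above_cyclic_of_down`: subsets of `S` lying inside some
within-family difference, cross meet, or double difference. -/

/-- The generators: within-family differences, cross meets and double differences. -/
def gens (P Q R : Finset (Finset α)) : Finset (Finset α) :=
  (P \\ P ∪ Q \\ Q ∪ R \\ R) ∪ (P ⊼ Q ∪ Q ⊼ R ∪ R ⊼ P) ∪
    (((P ×ˢ (Q ×ˢ R)).image fun p : Finset α × (Finset α × Finset α) => p.1 \ (p.2.1 ∪ p.2.2)) ∪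
     ((Q ×ˢ (R ×ˢ P)).image fun p : Finset α × (Finset α × Finset α) => p.1 \ (p.2.1 ∪ p.2.2)) ∪
     ((R ×ˢ (P ×ˢ Q)).image fun p : Finset α × (Finset α × Finset α) => p.1 \ (p.2.1 ∪ p.2.2)))

/-- The down-closed counted family `G(S; P, Q, R) = {F ⊆ S : F ⊆ T for some generator T}`. -/
def downFamily (S : Finset α) (P Q R : Finset (Finset α)) : Finset (Finset α) :=
  {F ∈ S.powerset | ∃ T ∈ gens P Q R, F ⊆ T}

/-- Membership in the counted family. -/
theorem mem_downFamily {S : Finset α} {P Q R : Finset (Finset α)} {F : Finset α} :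
    F ∈ downFamily S P Q R ↔ F ⊆ S ∧ ∃ T ∈ gens P Q R, F ⊆ T := by
  simp [downFamily]

/-- The counted family is down-closed. -/
theorem downFamily_down (S : Finset α) (P Q R : Finset (Finset α)) :
    ∀ E ∈ downFamily S P Q R, ∀ F, F ⊆ E → F ∈ downFamily S P Q R := by
  intro E hE F hFE
  rw [mem_downFamily] at hE ⊢
  obtain ⟨hES, T, hT, hET⟩ := hE
  exact ⟨hFE.trans hES, T, hT, hFE.trans hET⟩

/-- Within-family differences are generators. -/
theorem sdiff_mem_gens_of_mem {P Q R : Finset (Finset α)} {X X' : Finset α}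
    (h : (X ∈ P ∧ X' ∈ P) ∨ (X ∈ Q ∧ X' ∈ Q) ∨ (X ∈ R ∧ X' ∈ R)) : X \ X' ∈ gens P Q R := by
  simp only [gens, Finset.mem_union]
  left; left
  rcases h with ⟨h1, h2⟩ | ⟨h1, h2⟩ | ⟨h1, h2⟩
  · left; left; exact Finset.mem_diffs.mpr ⟨X, h1, X', h2, rfl⟩
  · left; right; exact Finset.mem_diffs.mpr ⟨X, h1, X', h2, rfl⟩
  · right; exact Finset.mem_diffs.mpr ⟨X, h1, X', h2, rfl⟩

/-- Cross meets (in the cyclic order `P ⊼ Q`, `Q ⊼ R`, `R ⊼ P`) are generators. -/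
theorem inter_mem_gens_of_mem {P Q R : Finset (Finset α)} {X Y : Finset α}
    (h : (X ∈ P ∧ Y ∈ Q) ∨ (X ∈ Q ∧ Y ∈ R) ∨ (X ∈ R ∧ Y ∈ P)) : X ∩ Y ∈ gens P Q R := by
  simp only [gens, Finset.mem_union]
  left; right
  rcases h with ⟨h1, h2⟩ | ⟨h1, h2⟩ | ⟨h1, h2⟩
  · left; left; exact Finset.mem_infs.mpr ⟨X, h1, Y, h2, rfl⟩
  · left; right; exact Finset.mem_infs.mpr ⟨X, h1, Y, h2, rfl⟩
  · right; exact Finset.mem_infs.mpr ⟨X, h1, Y, h2, rfl⟩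

/-- **`MS3-down` from `TRIPLE`.**  For three families of subsets of `S`, pairwise intersecting (in particular
cross-intersecting; co-intersection and incomparability are not needed here), the down-closed count
`#P + #Q + #R ≤ #G(S; P, Q, R)` holds as soon as the plain spans have trivial triple intersection in
`ℚ^{G(S;P,Q,R)}`. -/
theorem card_le_card_downFamily_of_triple (S : Finset α) (P Q R : Finset (Finset α))
    (hS : ∀ U ∈ P ∪ Q ∪ R, U ⊆ S)
    (hint : ∀ U ∈ P ∪ Q ∪ R, ∀ U' ∈ P ∪ Q ∪ R, (U ∩ U').Nonempty)
    (hTriple : V (downFamily S P Q R) P ⊓ V (downFamily S P Q R) Q ⊓ V (downFamily S P Q R) R = ⊥) :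
    #P + #Q + #R ≤ #(downFamily S P Q R) := by
  have hP : ∀ X ∈ P, X ∈ P ∪ Q ∪ R := fun X hX => by simp [hX]
  have hQ : ∀ Y ∈ Q, Y ∈ P ∪ Q ∪ R := fun Y hY => by simp [hY]
  have hR : ∀ Z ∈ R, Z ∈ P ∪ Q ∪ R := fun Z hZ => by simp [hZ]
  refine card_add_card_add_card_le_of_triple (downFamily S P Q R) (downFamily_down S P Q R) P Q R
    ?_ ?_ ?_ ?_ ?_ ?_ hTriple
  · intro X hX X' hX'
    exact mem_downFamily.mpr ⟨Finset.sdiff_subset.trans (hS X (hP X hX)), _,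
      sdiff_mem_gens_of_mem (Or.inl ⟨hX, hX'⟩), subset_rfl⟩
  · intro Y hY Y' hY'
    exact mem_downFamily.mpr ⟨Finset.sdiff_subset.trans (hS Y (hQ Y hY)), _,
      sdiff_mem_gens_of_mem (Or.inr (Or.inl ⟨hY, hY'⟩)), subset_rfl⟩
  · intro Z hZ Z' hZ'
    exact mem_downFamily.mpr ⟨Finset.sdiff_subset.trans (hS Z (hR Z hZ)), _,
      sdiff_mem_gens_of_mem (Or.inr (Or.inr ⟨hZ, hZ'⟩)), subset_rfl⟩
  · intro X hX Y hY
    exact ⟨mem_downFamily.mpr ⟨Finset.inter_subset_left.trans (hS X (hP X hX)), _,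
      inter_mem_gens_of_mem (Or.inl ⟨hX, hY⟩), subset_rfl⟩, hint X (hP X hX) Y (hQ Y hY)⟩
  · intro Y hY Z hZ
    exact ⟨mem_downFamily.mpr ⟨Finset.inter_subset_left.trans (hS Y (hQ Y hY)), _,
      inter_mem_gens_of_mem (Or.inr (Or.inl ⟨hY, hZ⟩)), subset_rfl⟩, hint Y (hQ Y hY) Z (hR Z hZ)⟩
  · intro Z hZ X hX
    exact ⟨mem_downFamily.mpr ⟨Finset.inter_subset_left.trans (hS Z (hR Z hZ)), _,
      inter_mem_gens_of_mem (Or.inr (Or.inr ⟨hZ, hX⟩)), subset_rfl⟩, hint Z (hR Z hZ) X (hP X hX)⟩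

end ThreeFamilyRank

namespace OrientedAntipodalHall

open Finset AntipodalStrongHarris AntipodalStrongHarris.Lab ThreeFamilyRank

variable {α : Type*} [DecidableEq α] {k : ℕ}

/-- **Cyclic selections: the Hall count from `TRIPLE`.**  The conclusion of
`card_le_card_goods_above_cyclic_of_down` with its combinatorial hypothesis `hMS3down` replaced by the
linear-algebra statement `TRIPLE`: for all `LAB=1` triples `P, Q, R` of families in `S`, the spans in
`ℚ^{G(S;P,Q,R)}` of the plain vectors of the three families have trivial triple intersection.
(`TRIPLE ⟹ MS3-down` is `ThreeFamilyRank.card_le_card_downFamily_of_triple`.) -/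
theorem card_le_card_goods_above_cyclic_of_triple (S : Finset α) {f : Finset α → Lab k}
    (hf : ∀ ⦃X Y : Finset α⦄, X ⊆ Y → f X ≤ f Y) (D₁ D₂ D₃ : Finset (Finset α)) {i j l : Fin k}
    (hij : i ≠ j) (hjl : j ≠ l) (hil : i ≠ l)
    (h₁S : ∀ X ∈ D₁, X ⊆ S) (h₁i : ∀ X ∈ D₁, f X = petal i) (h₁j : ∀ X ∈ D₁, f (S \ X) = petal j)
    (h₂S : ∀ X ∈ D₂, X ⊆ S) (h₂j : ∀ X ∈ D₂, f X = petal j) (h₂l : ∀ X ∈ D₂, f (S \ X) = petal l)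
    (h₃S : ∀ X ∈ D₃, X ⊆ S) (h₃l : ∀ X ∈ D₃, f X = petal l) (h₃i : ∀ X ∈ D₃, f (S \ X) = petal i)
    (hTriple : ∀ P Q R : Finset (Finset α),
      (∀ U ∈ P ∪ Q ∪ R, U ⊆ S) →
      (∀ U ∈ P ∪ Q ∪ R, ∀ U' ∈ P ∪ Q ∪ R, (U ∩ U').Nonempty) →
      (∀ U ∈ P ∪ Q ∪ R, ∀ U' ∈ P ∪ Q ∪ R, U ∪ U' ≠ S) →
      (∀ U ∈ P, ∀ U' ∈ Q, ¬ U ⊆ U' ∧ ¬ U' ⊆ U) →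
      (∀ U ∈ Q, ∀ U' ∈ R, ¬ U ⊆ U' ∧ ¬ U' ⊆ U) →
      (∀ U ∈ R, ∀ U' ∈ P, ¬ U ⊆ U' ∧ ¬ U' ⊆ U) →
      V (downFamily S P Q R) P ⊓ V (downFamily S P Q R) Q ⊓ V (downFamily S P Q R) R = ⊥) :
    #D₁ + #D₂ + #D₃ ≤
      #{U ∈ S.powerset | f U = top ∧ f (S \ U) = bot ∧ ∃ X ∈ D₁ ∪ D₂ ∪ D₃, X ⊆ U} :=
  card_le_card_goods_above_cyclic_of_down S hf D₁ D₂ D₃ hij hjl hil h₁S h₁i h₁j h₂S h₂j h₂l h₃S h₃l h₃i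
    (fun P Q R h1 h2 h3 h4 h5 h6 =>
      card_le_card_downFamily_of_triple S P Q R h1 h2 (hTriple P Q R h1 h2 h3 h4 h5 h6))

end OrientedAntipodalHall

end Summit.CriticalPhenomena.PercolationContinuityZ3.Theorems
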